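import Summits.CriticalPhenomena.PercolationContinuityZ3.Theorems.SahiCISCoupling

/-!
# The cylinder criterion for CIS, repaired: strictly separated boxes suffice when the conditioning coordinates are
# atomless (every dimension), and always in dimension 2

Cell `prim-sahi`, typer (generation 17); `--supports stmt-CriticalPhenomena-4575`.  No named facts, no sorries.

Colangelo–Müller–Scarsini's Theorem 4 (J. Appl. Probab. 43 (2006), §4) asserts that the cylinder condition (c) —
`µ^{(k+1)}(A × V) µ^{(k)}(B) ≤ µ^{(k+1)}(B × V) µ^{(k)}(A)` for STRICTLY separated intervals `A < B ⊆ ℝ^k` and upper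
sets `V ⊆ ℝ` — yields stochastically increasing disintegration kernels.  As printed this fails for `k ≥ 2`
(`SahiCISDefinitionFour.lean`: strictly separated boxes never compare conditioning points sharing a coordinate).  This
file proves what IS true, on the cube `Q_{d+1}` and for the a.e.-kernel notion `IsCISae` of `SahiCISCoupling.lean`:

* `CondIncrLast μ` — condition (c) for the last coordinate of a law on `Q_{d+1}`: closed boxes `[a,c] < [a',c']`
  over the first `d` coordinates, strictly separated in EVERY coordinate, all measurable upper sets `V ⊆ [0,1]`.
* `exists_kernel_anti_of_condIncrLast` — Besicovitch differentiation on the conditioning cube (the generation-11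
  machinery `SahiBoxTP2Kernel.goodSet₀`, with the ball inequality now available only for small radii and strictly
  ordered centres): the conditional-cdf kernel is stochastically increasing along every STRICTLY ordered pair
  (`a_i < b_i` for all `i`) of the full-measure good set.
* **`aepairMonoKernel_of_condIncrLast`** — hence stochastically increasing on ALMOST EVERY comparable pair as soon as
  almost every comparable pair of distinct conditioning points is strictly ordered; this holds
  (`ae_pair_strict_of_noAtoms`) when every conditioning coordinate has an ATOMLESS marginal (pairs sharing a
  coordinate are then `µ^{(d)} ⊗ µ^{(d)}`-null), and trivially when `d = 1` (one conditioning coordinate: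
  `ae_pair_strict_one`).
* **`isCISae_succ_of_condIncrLast_of_noAtoms`**, **`isCISae_two_of_condIncrLast`**, and the all-levels form
  **`IsCIScyl.isCISae_of_noAtoms`** (`IsCIScyl` = condition (c) at every level): Theorem 4 (c) ⇒ (b) of the source,
  REPAIRED — for laws on `Q_d` whose one-dimensional marginals of the conditioning coordinates have no atoms, and
  unconditionally on `Q_2`.  With `SahiCISPositivity.lean`: such laws are monotone images of Lebesgue measure,
  positively associated, and Sahi-positive of order `n` given `L(d,n)`.

References: Colangelo–Müller–Scarsini 2006, Thm. 4 [ColangeloMullerScarsini2006]; Müller–Stoyan 2002, Lemma 3.10.10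
[MullerStoyan2002].  The atomless repair and the a.e.-pair conclusion are this work.
-/

noncomputable section

namespace Summit.CriticalPhenomena.PercolationContinuityZ3.Theorems.SahiCIS

open MeasureTheory ProbabilityTheory Set Filter Topology Metric Function
open Summit.CriticalPhenomena.PercolationContinuityZ3.Theorems.SahiBoxTP2
open scoped ENNReal unitInterval

/-! ### Besicovitch kernels from ball inequalities that hold only for small radii -/

section BallPair

variable {α : Type*} [MetricSpace α] [MeasurableSpace α] [BorelSpace α]

/-- One instance of the ball-ratio comparison: the cross inequality at `(a, b, h, q)` gives
`ρ(B̄(b,h) × (-∞,q]) / ρ.fst(B̄(b,h)) ≤ ρ(B̄(a,h) × (-∞,q]) / ρ.fst(B̄(a,h))`. [this work] -/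
theorem ball_ratio_le_of_cross (ρ : Measure (α × ℝ)) [IsFiniteMeasure ρ] {a b : α} {h : ℝ} (q : ℝ)
    (key : ρ (closedBall a h ×ˢ Ioi q) * ρ (closedBall b h ×ˢ Iic q) ≤
      ρ (closedBall a h ×ˢ Iic q) * ρ (closedBall b h ×ˢ Ioi q))
    (hpos : 0 < ρ.fst (closedBall a h)) :
    ρ.IicSnd q (closedBall b h) / ρ.fst (closedBall b h) ≤
      ρ.IicSnd q (closedBall a h) / ρ.fst (closedBall a h) := by
  rw [Measure.IicSnd_apply _ _ measurableSet_closedBall, Measure.IicSnd_apply _ _ measurableSet_closedBall,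
    fst_eq_add_prod_compl ρ measurableSet_closedBall (measurableSet_Iic (a := q)),
    fst_eq_add_prod_compl ρ measurableSet_closedBall (measurableSet_Iic (a := q))]
  rw [fst_eq_add_prod_compl ρ measurableSet_closedBall (measurableSet_Iic (a := q))] at hpos
  have key' : ρ (closedBall a h ×ˢ (Iic q)ᶜ) * ρ (closedBall b h ×ˢ Iic q) ≤
      ρ (closedBall a h ×ˢ Iic q) * ρ (closedBall b h ×ˢ (Iic q)ᶜ) := by
    rw [Set.compl_Iic]; exact key
  exact SahiTP2.div_add_le_div_add key' hpos.ne' (ENNReal.add_ne_top.2 ⟨measure_ne_top _ _, measure_ne_top _ _⟩)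
    (ENNReal.add_ne_top.2 ⟨measure_ne_top _ _, measure_ne_top _ _⟩)

/-- **Mathlib's conditional cdf is antitone along a pair of good points** at which the cross inequality holds for
all small radii (the inequality need not hold for large radii). [this work] -/
theorem condCDF_anti_of_eventually_cross (ρ : Measure (α × ℝ)) [IsFiniteMeasure ρ] {a b : α}
    (ha : a ∈ goodSet₀ ρ) (hb : b ∈ goodSet₀ ρ)
    (hcross : ∀ᶠ h in 𝓝[>] (0 : ℝ), ∀ q : ℝ, ρ (closedBall a h ×ˢ Ioi q) * ρ (closedBall b h ×ˢ Iic q) ≤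
      ρ (closedBall a h ×ˢ Iic q) * ρ (closedBall b h ×ˢ Ioi q)) (x : ℝ) :
    condCDF ρ b x ≤ condCDF ρ a x := by
  have hpre : ∀ q : ℚ, preCDF ρ q b ≤ preCDF ρ q a := fun q => by
    refine le_of_tendsto_of_tendsto (hb.1 q) (ha.1 q) ?_
    filter_upwards [hcross, self_mem_nhdsWithin] with h hh hpos
    exact ball_ratio_le_of_cross ρ (q : ℝ) (hh q) (ha.2.2.2 h hpos)
  have hval : ∀ c ∈ goodSet₀ ρ, ∀ r : ℚ, condCDF ρ c r = (preCDF ρ r c).toReal := fun c hc r => by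
    rw [condCDF, stieltjesOfMeasurableRat_eq, toRatCDF_of_isRatStieltjesPoint hc.2.1]
  rw [← StieltjesFunction.iInf_rat_gt_eq (condCDF ρ b) x, ← StieltjesFunction.iInf_rat_gt_eq (condCDF ρ a) x]
  have hbdd : BddBelow (range fun r : {r' : ℚ // x < r'} => condCDF ρ b r) :=
    ⟨0, by rintro y ⟨r, rfl⟩; exact condCDF_nonneg ρ b _⟩
  refine ciInf_mono hbdd fun r => ?_
  rw [hval b hb, hval a ha]
  exact ENNReal.toReal_mono ((ha.2.2.1 r).trans_lt ENNReal.one_lt_top).ne (hpre r)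

/-- **The conditional-cdf kernel, pairwise form.** Every finite measure `ρ` on `α × ℝ` (`α` second countable with the
Besicovitch covering property) is `ρ.fst ⊗ₘ κ` for a Markov kernel `κ` such that `κ_b((-∞,t]) ≤ κ_a((-∞,t])` for every
pair `a, b` of the full-measure good set `goodSet₀ ρ` along which the cross inequality holds for all small radii.
[this work] -/
theorem exists_kernel_anti_of_eventually_cross [SecondCountableTopology α] [HasBesicovitchCovering α]
    (ρ : Measure (α × ℝ)) [IsFiniteMeasure ρ] :
    ∃ κ : Kernel α ℝ, IsMarkovKernel κ ∧ ρ.fst ⊗ₘ κ = ρ ∧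
      ∀ ⦃a b : α⦄, a ∈ goodSet₀ ρ → b ∈ goodSet₀ ρ →
        (∀ᶠ h in 𝓝[>] (0 : ℝ), ∀ q : ℝ, ρ (closedBall a h ×ˢ Ioi q) * ρ (closedBall b h ×ˢ Iic q) ≤
          ρ (closedBall a h ×ˢ Iic q) * ρ (closedBall b h ×ˢ Ioi q)) →
        ∀ t : ℝ, κ b (Iic t) ≤ κ a (Iic t) := by
  have hK := isCondKernelCDF_condCDF ρ
  set K := hK.toKernel _ with hKdef
  refine ⟨Kernel.comap K (fun a => ((), a)) measurable_prodMk_left, inferInstance, ?_, fun a b ha hb hcross t => ?_⟩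
  · have h2 : Kernel.prodMkLeft Unit (Kernel.comap K (fun a => ((), a)) measurable_prodMk_left) = K := by
      ext p s hs
      rcases p with ⟨u, a⟩
      rfl
    have h3 : Kernel.const Unit ρ.fst ⊗ₖ K = Kernel.const Unit ρ := compProd_toKernel hK
    rw [Measure.compProd, h2, h3, Kernel.const_apply]
  · rw [Kernel.comap_apply, Kernel.comap_apply, hKdef, IsCondKernelCDF.toKernel_Iic, IsCondKernelCDF.toKernel_Iic]
    exact ENNReal.ofReal_le_ofReal (condCDF_anti_of_eventually_cross ρ ha hb hcross t)

end BallPair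

/-! ### The cylinder condition for the last coordinate of a law on the cube -/

section Cube

variable {d : ℕ}

/-- **Condition (c) of Colangelo–Müller–Scarsini's Theorem 4 for the last coordinate of a law `μ` on `Q_{d+1}`**:
for all closed boxes `[a,c]`, `[a',c']` over the first `d` coordinates that are strictly separated in every coordinate
(`c_i < a'_i`) and every measurable upper set `V ⊆ [0,1]`,
`µ(x' ∈ [a,c], x_d ∈ V) µ(x' ∈ [a',c']) ≤ µ(x' ∈ [a',c'], x_d ∈ V) µ(x' ∈ [a,c])` (`x'` = first `d` coordinates).
[cite: ColangeloMullerScarsini2006, Thm. 4 (c)] -/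
def CondIncrLast (μ : Measure (Fin (d + 1) → I)) : Prop :=
  ∀ ⦃a c a' c' : Fin d → I⦄, (∀ i, c i < a' i) → ∀ ⦃V : Set I⦄, IsUpperSet V → MeasurableSet V →
    μ.map initLast (Icc a c ×ˢ V) * (μ.map initLast).fst (Icc a' c') ≤
      μ.map initLast (Icc a' c' ×ˢ V) * (μ.map initLast).fst (Icc a c)

/-- **Condition (c) at every level**, by recursion on the dimension. [cite: ColangeloMullerScarsini2006, Thm. 4 (c)] -/
def IsCIScyl : (d : ℕ) → Measure (Fin d → I) → Prop
  | 0, _ => True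
  | d + 1, μ => IsCIScyl d (μ.map initLast).fst ∧ CondIncrLast μ

/-- The first marginal splits along a measurable set of the second coordinate and its complement (any second
factor). [folklore] -/
theorem fst_eq_add_prod_compl' {α β : Type*} [MeasurableSpace α] [MeasurableSpace β] (ρ : Measure (α × β))
    {s : Set α} (hs : MeasurableSet s) {L : Set β} (hL : MeasurableSet L) :
    ρ.fst s = ρ (s ×ˢ L) + ρ (s ×ˢ Lᶜ) := by
  rw [Measure.fst_apply hs, ← Set.prod_univ, ← Set.union_compl_self L, Set.prod_union]
  exact measure_union (Set.disjoint_prod.2 (Or.inr disjoint_compl_right)) (hs.prod hL.compl)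

/-- From the ratio form with the upper set `V = {v : t < v}` to the cross form with its complement.
[this work] -/
theorem cross_of_condIncrLast {μ : Measure (Fin (d + 1) → I)} [IsFiniteMeasure μ] (hC : CondIncrLast μ)
    {a c a' c' : Fin d → I} (hsep : ∀ i, c i < a' i) (t : ℝ) :
    lawInitLastReal μ (Icc a c ×ˢ Ioi t) * lawInitLastReal μ (Icc a' c' ×ˢ Iic t) ≤
      lawInitLastReal μ (Icc a c ×ˢ Iic t) * lawInitLastReal μ (Icc a' c' ×ˢ Ioi t) := by
  haveI : IsFiniteMeasure (μ.map initLast) := Measure.isFiniteMeasure_map μ _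
  rw [lawInitLastReal_prod μ measurableSet_Icc measurableSet_Ioi, lawInitLastReal_prod μ measurableSet_Icc measurableSet_Iic,
    lawInitLastReal_prod μ measurableSet_Icc measurableSet_Iic, lawInitLastReal_prod μ measurableSet_Icc measurableSet_Ioi]
  have hUm : MeasurableSet (((↑) : I → ℝ) ⁻¹' Ioi t) := measurable_subtype_coe measurableSet_Ioi
  have hUup : IsUpperSet (((↑) : I → ℝ) ⁻¹' Ioi t) := fun v w hvw hv =>
    lt_of_lt_of_le (show t < (v : ℝ) from hv) (Subtype.coe_le_coe.2 hvw)
  have hLU : ((↑) : I → ℝ) ⁻¹' Iic t = (((↑) : I → ℝ) ⁻¹' Ioi t)ᶜ := by ext v; simp [not_lt]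
  rw [hLU]
  set U : Set I := ((↑) : I → ℝ) ⁻¹' Ioi t with hU
  set A : Set (Fin d → I) := Icc a c with hA
  set B : Set (Fin d → I) := Icc a' c' with hB
  set ν := μ.map initLast with hν
  have key : ν (A ×ˢ U) * ν.fst B ≤ ν (B ×ˢ U) * ν.fst A := hC hsep hUup hUm
  have hAm : MeasurableSet A := measurableSet_Icc
  have hBm : MeasurableSet B := measurableSet_Icc
  rw [fst_eq_add_prod_compl' ν hBm hUm, fst_eq_add_prod_compl' ν hAm hUm, mul_add, mul_add,
    mul_comm (ν (B ×ˢ U)) (ν (A ×ˢ U))] at key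
  have hfin : ν (A ×ˢ U) * ν (B ×ˢ U) ≠ ⊤ := ENNReal.mul_ne_top (measure_ne_top _ _) (measure_ne_top _ _)
  have h := (ENNReal.add_le_add_iff_left hfin).1 key
  rw [mul_comm (ν (B ×ˢ U))] at h
  exact h

/-- For strictly ordered centres `a_i < b_i`, small sup-balls are strictly separated boxes. [folklore] -/
theorem eventually_hiCorner_lt_loCorner {a b : Fin d → I} (hab : ∀ i, a i < b i) :
    ∀ᶠ h in 𝓝[>] (0 : ℝ), ∀ i, hiCorner a h i < loCorner b h i := by
  have hgap : ∀ i, ∀ᶠ h in 𝓝 (0 : ℝ), 2 * h < (b i : ℝ) - a i := fun i => by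
    have hpos : (0 : ℝ) < ((b i : ℝ) - a i) / 2 := by
      have := Subtype.coe_lt_coe.2 (hab i); linarith
    exact (eventually_lt_nhds hpos).mono fun h hh => by linarith
  have h1 : ∀ᶠ h in 𝓝[>] (0 : ℝ), ∀ i, 2 * h < (b i : ℝ) - a i :=
    eventually_nhdsWithin_of_eventually_nhds (Filter.eventually_all.2 hgap)
  filter_upwards [h1, self_mem_nhdsWithin] with h hh hpos i
  have hpos' : 0 < h := hpos
  have h0a := (a i).2.1
  have h1b := (b i).2.2
  apply Subtype.coe_lt_coe.1
  simp only [hiCorner, loCorner, coe_projIcc]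
  have e1 : max (0 : ℝ) (min 1 ((a i : ℝ) + h)) ≤ (a i : ℝ) + h := max_le (by linarith) (min_le_right _ _)
  have e2 : (b i : ℝ) - h ≤ max (0 : ℝ) (min 1 ((b i : ℝ) - h)) := le_max_of_le_right (le_min (by linarith) le_rfl)
  have := hh i
  linarith

/-- **The cross inequality on small concentric sup-balls around strictly ordered centres**, from condition (c).
[this work] -/
theorem eventually_cross_of_condIncrLast {μ : Measure (Fin (d + 1) → I)} [IsFiniteMeasure μ] (hC : CondIncrLast μ)
    {a b : Fin d → I} (hab : ∀ i, a i < b i) :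
    ∀ᶠ h in 𝓝[>] (0 : ℝ), ∀ q : ℝ,
      lawInitLastReal μ (closedBall a h ×ˢ Ioi q) * lawInitLastReal μ (closedBall b h ×ˢ Iic q) ≤
        lawInitLastReal μ (closedBall a h ×ˢ Iic q) * lawInitLastReal μ (closedBall b h ×ˢ Ioi q) := by
  filter_upwards [eventually_hiCorner_lt_loCorner hab, self_mem_nhdsWithin] with h hsep hpos q
  rw [closedBall_eq_Icc a (le_of_lt hpos), closedBall_eq_Icc b (le_of_lt hpos)]
  exact cross_of_condIncrLast hC hsep q

/-- **The kernel from condition (c)**: a Markov disintegration kernel of the last coordinate (read in `ℝ`) that is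
stochastically increasing along every STRICTLY ordered pair of the good set. [this work] -/
theorem exists_kernel_anti_of_condIncrLast {μ : Measure (Fin (d + 1) → I)} [IsProbabilityMeasure μ]
    (hC : CondIncrLast μ) :
    ∃ κ : Kernel (Fin d → I) ℝ, IsMarkovKernel κ ∧ (lawInitLastReal μ).fst ⊗ₘ κ = lawInitLastReal μ ∧
      ∀ ⦃a b : Fin d → I⦄, a ∈ goodSet₀ (lawInitLastReal μ) → b ∈ goodSet₀ (lawInitLastReal μ) →
        (∀ i, a i < b i) → ∀ t : ℝ, κ b (Iic t) ≤ κ a (Iic t) := by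
  obtain ⟨κ, hκ, hdis, hmono⟩ := exists_kernel_anti_of_eventually_cross (lawInitLastReal μ)
  exact ⟨κ, hκ, hdis, fun a b ha hb hab => hmono ha hb (eventually_cross_of_condIncrLast hC hab)⟩

/-! ### Almost every comparable pair is strictly ordered -/

/-- Pairs of conditioning points agreeing in coordinate `i` are `ν ⊗ ν`-null when the `i`-th marginal of `ν` has no
atoms. [this work] -/
theorem prod_setOf_apply_eq_zero (ν : Measure (Fin d → I)) [SFinite ν] (i : Fin d)
    (hna : ∀ x : I, ν {a | a i = x} = 0) :
    ν.prod ν {p : (Fin d → I) × (Fin d → I) | p.1 i = p.2 i} = 0 := by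
  have hmeas : MeasurableSet {p : (Fin d → I) × (Fin d → I) | p.1 i = p.2 i} :=
    (isClosed_eq ((continuous_apply i).comp continuous_fst) ((continuous_apply i).comp continuous_snd)).measurableSet
  rw [Measure.prod_apply hmeas]
  have h : ∀ a : Fin d → I, ν (Prod.mk a ⁻¹' {p : (Fin d → I) × (Fin d → I) | p.1 i = p.2 i}) = 0 := fun a => by
    have hset : Prod.mk a ⁻¹' {p : (Fin d → I) × (Fin d → I) | p.1 i = p.2 i} = {b | b i = a i} := by
      ext b; simp [eq_comm]
    rw [hset]; exact hna (a i)
  simp only [h, lintegral_zero]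

/-- **Atomless marginals ⇒ almost every comparable pair of distinct points is strictly ordered.** [this work] -/
theorem ae_pair_strict_of_noAtoms (ν : Measure (Fin d → I)) [SFinite ν]
    (hna : ∀ (i : Fin d) (x : I), ν {a | a i = x} = 0) :
    ∀ᵐ p ∂(ν.prod ν), p.1 ≤ p.2 → p.1 ≠ p.2 → ∀ i, p.1 i < p.2 i := by
  have hnull : ν.prod ν {p : (Fin d → I) × (Fin d → I) | ∃ i, p.1 i = p.2 i} = 0 := by
    rw [Set.setOf_exists]
    exact measure_iUnion_null fun i => prod_setOf_apply_eq_zero ν i (hna i)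
  have h : ∀ᵐ p ∂(ν.prod ν), ¬ ∃ i, p.1 i = p.2 i := by
    rw [ae_iff]; simpa only [not_not] using hnull
  filter_upwards [h] with p hp hle _ i
  exact lt_of_le_of_ne (hle i) fun heq => hp ⟨i, heq⟩

/-- With ONE conditioning coordinate every comparable pair of distinct points is strictly ordered. [folklore] -/
theorem ae_pair_strict_one (ν : Measure (Fin 1 → I)) :
    ∀ᵐ p ∂(ν.prod ν), p.1 ≤ p.2 → p.1 ≠ p.2 → ∀ i, p.1 i < p.2 i :=
  ae_of_all _ fun p hle hne i => lt_of_le_of_ne (hle i) fun heq => hne (funext fun j => by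
    rw [Subsingleton.elim j i]; exact heq)

/-! ### Condition (c) ⇒ CIS in the a.e.-kernel sense -/

/-- **Condition (c) gives an a.e.-pair stochastically increasing kernel of the last coordinate**, provided almost
every comparable pair of distinct conditioning points is strictly ordered. [this work] -/
theorem aepairMonoKernel_of_condIncrLast (μ : Measure (Fin (d + 1) → I)) [IsProbabilityMeasure μ]
    (hC : CondIncrLast μ)
    (hstrict : ∀ᵐ p ∂((μ.map initLast).fst.prod (μ.map initLast).fst), p.1 ≤ p.2 → p.1 ≠ p.2 → ∀ i, p.1 i < p.2 i) :
    ∃ κ : Kernel (Fin d → I) I, IsMarkovKernel κ ∧ (μ.map initLast).fst ⊗ₘ κ = μ.map initLast ∧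
      AEPairMonoKernel (μ.map initLast).fst κ := by
  obtain ⟨κ, hκM, hdis, hmono⟩ := exists_kernel_anti_of_condIncrLast hC
  have hT : ∀ᵐ a ∂(μ.map initLast).fst, a ∈ goodSet₀ (lawInitLastReal μ) := by
    rw [← fst_lawInitLastReal]; exact ae_mem_goodSet₀
  rw [fst_lawInitLastReal] at hdis
  have hproj : Measurable (projIcc (0 : ℝ) 1 zero_le_one) := continuous_projIcc.measurable
  haveI := Kernel.IsMarkovKernel.map κ hproj
  refine ⟨κ.map (projIcc (0 : ℝ) 1 zero_le_one), inferInstance, compProd_map_projIcc_eq (μ.map initLast) κ hdis, ?_⟩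
  filter_upwards [ae_prod_fst_mem (ν := (μ.map initLast).fst) hT, ae_prod_snd_mem (μ := (μ.map initLast).fst) hT,
    hstrict] with p h1 h2 h3 hle y
  by_cases heq : p.1 = p.2
  · rw [heq]
  · exact map_projIcc_Iic_le κ (hmono h1 h2 (h3 hle heq)) y

/-- **Theorem 4 (c) ⇒ (b), repaired, one level**: if the first `d` coordinates are `IsCISae d`, condition (c) holds for
the last coordinate, and every one of the first `d` coordinates has an atomless marginal, then `μ` is `IsCISae (d+1)`.
[this work] -/
theorem isCISae_succ_of_condIncrLast_of_noAtoms (μ : Measure (Fin (d + 1) → I)) [IsProbabilityMeasure μ]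
    (h1 : IsCISae d (μ.map initLast).fst) (hC : CondIncrLast μ)
    (hna : ∀ (i : Fin d) (x : I), (μ.map initLast).fst {a | a i = x} = 0) : IsCISae (d + 1) μ := by
  obtain ⟨κ, hκ, hdis, hmono⟩ :=
    aepairMonoKernel_of_condIncrLast μ hC (ae_pair_strict_of_noAtoms _ hna)
  exact ⟨h1, κ, hκ, hdis, hmono⟩

/-- **In dimension 2 condition (c) alone gives CIS** (one conditioning coordinate: Definition 4 / Theorem 4 of the
source are correct for `d ≤ 2`). [this work] -/
theorem isCISae_two_of_condIncrLast (μ : Measure (Fin 2 → I)) [IsProbabilityMeasure μ] (hC : CondIncrLast μ) :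
    IsCISae 2 μ := by
  obtain ⟨κ, hκ, hdis, hmono⟩ := aepairMonoKernel_of_condIncrLast μ hC (ae_pair_strict_one _)
  refine ⟨?_, κ, hκ, hdis, hmono⟩
  haveI : IsFiniteMeasure ((μ.map initLast).fst) := inferInstance
  -- every finite law on `Q_1` is `IsCISae 1`: nothing to condition on
  rw [isCISae_succ_iff_condKernel]
  exact ⟨isCISae_zero _, ae_of_all _ fun p _ x => by rw [Subsingleton.elim p.2 p.1]⟩

/-- Coordinates of the first-`d` marginal are coordinates of `μ`. [folklore] -/
theorem map_initLast_fst_apply_setOf_eval (μ : Measure (Fin (d + 1) → I)) (i : Fin d) (x : I) :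
    (μ.map initLast).fst {a | a i = x} = μ {z | z (Fin.castSucc i) = x} := by
  have hm : MeasurableSet {a : Fin d → I | a i = x} := measurableSet_eq_fun (measurable_pi_apply i) measurable_const
  rw [Measure.fst_apply hm, Measure.map_apply measurable_initLast (measurable_fst hm)]
  congr 1
  ext z
  simp only [mem_preimage, mem_setOf_eq]
  change z ((Fin.last d).succAbove i) = x ↔ z (Fin.castSucc i) = x
  rw [Fin.succAbove_last]

/-- **Theorem 4 (c) ⇒ (b), repaired, all levels**: condition (c) at every level and atomless one-dimensional marginals
give CIS in the a.e.-kernel sense (hence — `SahiCISPositivity.lean` — a monotone coupling to Lebesgue measure,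
positive association, Sahi positivity given `L(d,n)`). [this work] -/
theorem IsCIScyl.isCISae_of_noAtoms :
    ∀ (d : ℕ) (μ : Measure (Fin d → I)) [IsProbabilityMeasure μ], IsCIScyl d μ →
      (∀ (i : Fin d) (x : I), μ {z | z i = x} = 0) → IsCISae d μ := by
  intro d
  induction d with
  | zero => intro μ _ _ _; trivial
  | succ d ih =>
    rintro μ _ ⟨hcyl, hC⟩ hna
    have hna' : ∀ (i : Fin d) (x : I), (μ.map initLast).fst {a | a i = x} = 0 := fun i x => by
      rw [map_initLast_fst_apply_setOf_eval]; exact hna _ x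
    exact isCISae_succ_of_condIncrLast_of_noAtoms μ (ih _ hcyl hna') hC hna'

end Cube

end Summit.CriticalPhenomena.PercolationContinuityZ3.Theorems.SahiCIS

end
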